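import Literature.AlgebraicGeometry.HodgeTheory.InvariantClassesFromTotalSpaceCurveBase
import Literature.AlgebraicTopology.Homotopy.SerreFibrationFibrewiseScalarExhaustion
import HarnessLib

/-!
# An endomorphism of a family over a smooth affine CURVE acting as a scalar on the fibres acts as that scalar on the
# classes of the total space vanishing on the fibres (the middle Leray piece `H¹(S, Rᵏ f_*)`)

Family `hodge`, layer `Literature/AlgebraicGeometry/HodgeTheory`. PROOF FILE (theorems only; no definition, no named
fact). Companion of `InvariantClassesFromTotalSpaceCurveBase` (the partie fixe over affine curves is topological).

Let `f : 𝒳 ⟶ S` be a smooth proper family with smooth projective fibres over a smooth AFFINE CURVE `S` and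
`ν : 𝒳 ⟶ 𝒳` an endomorphism OVER `S` (`ν ≫ f = f`) whose restriction to every fibre `X_s` acts on `Hᵏ(X_s(ℂ); ℂ)` as
the scalar `c`. Since `S(ℂ)` has the homotopy type of a `1`-dimensional CW complex (Andreotti–Frankel), the Leray
spectral sequence of `f(ℂ)` has the two columns `E₂^{0,q} = H⁰(S, Rᵠf_*)`, `E₂^{1,q} = H¹(S, Rᵠ f_*)`, and
`ker (H^{k+1}(𝒳) → ∏ₛ H^{k+1}(X_s)) = L¹H^{k+1} = H¹(S(ℂ), Rᵏ f_* ℂ)`, on which `ν` acts through its action on the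
coefficient system `Rᵏ f_* ℂ`, i.e. as `c` (Voisin II §4.2.3; the case in print: the multiplication `θ_N` of an
abelian scheme acts on `Hⁱ(S, Rʲ f_*ℚ)` as `Nʲ` — Kleiman 1968 p. 374, Milne 2020 proof of Prop. 1, Deninger–Murre
1991). PROVED here without the spectral sequence, from the topological theorem
`SerreFibrewiseScalar.map_eq_smul_of_forall_res_eq_zero_of_exhaustion` (Mayer–Vietoris over `1`-skeleta, compact
supports, Kronecker duality) and Ehresmann (`f(ℂ)` is a Serre fibration):

* `map_eq_smul_of_forall_map_fiberι_eq_zero_of_affineCurveBase` — **`ν^* z = c·z` for every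
  `z ∈ H^{k+1}(𝒳(ℂ); ℂ)` vanishing on every fibre**, for every such family over a smooth affine curve. NO
  projectivity of `f` or of `𝒳`, no Hodge theory.

Consumer: the Leray weights of `θ_N` on a compact abelian pencil punctured at a point (Hodge summit, Ring 2, André
axis, part XXV: the clause (roots) of `Ring2AbelianAllAndreWeightRoots`).

## References

* [VoisinHodgeII2003] C. Voisin, Hodge Theory and Complex Algebraic Geometry II (CUP 2003), §1.2.2 Thm. 1.22,
  §4.2.3, Thm. 4.15, §4.3.1.
* [Milne2020HodgeClassesAV] J. S. Milne, Hodge classes on abelian varieties (2020), proof of Prop. 1 (p. 7).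
* [Kleiman1968AlgebraicCycles] S. Kleiman, Algebraic cycles and the Weil conjectures (1968), p. 374.
* [Milnor1963] J. Milnor, Morse theory (1963), §7 Thm. 7.2.
* [HatcherAT2002] A. Hatcher, Algebraic Topology (CUP 2002), §2.2, §3.1 Thm. 3.2, Prop. 3.33.
-/

noncomputable section

open CategoryTheory AlgebraicGeometry Filter TopologicalSpace Set Function
open scoped Manifold ContDiff Topology
open Literature.AlgebraicTopology.SingularHomology
open Literature.AlgebraicTopology.Homotopy
open Literature.Algebra.Homology Literature.Geometry.Kaehler

namespace Literature.AlgebraicGeometry.HodgeTheory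

open _root_.Topology
open Literature.AlgebraicGeometry.Motives

section Family

variable {𝒳 S : Motives.SchemeOver ℂ} (f : 𝒳 ⟶ S)

/-- **An `S`-endomorphism acting as `c` on `Hᵏ` of every fibre acts as `c` on the classes of `H^{k+1}(𝒳(ℂ); ℂ)`
vanishing on every fibre — over a smooth affine curve, for every smooth proper family with smooth projective fibres.**
Let `f : 𝒳 ⟶ S` satisfy `IsSmoothProjectiveFamily f n₀` with `S` affine and smooth of relative dimension `1`,
`ν : 𝒳 ⟶ 𝒳` with `ν ≫ f = f`, and suppose that at every complex point `s` some restriction `ν_s` of `ν` to the fibre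
(`ν_s ≫ j_s = j_s ≫ ν`) acts on `Hᵏ(X_s(ℂ); ℂ)` as `c`. Then `ν^* z = c·z` for every `z ∈ H^{k+1}(𝒳(ℂ); ℂ)` with
`j_s^* z = 0` for all `s`. Proof: `f(ℂ)` is a Serre fibration (Ehresmann); `S(ℂ)` is exhausted by the open sublevel
sets of the proper Morse function of Andreotti–Frankel inside compact sublevel sets homotopy equivalent to finite CW
complexes without cells of dimension `> 1` (Milnor Thm. 7.2); over such a base the topological theorem
`SerreFibrewiseScalar.map_eq_smul_of_forall_res_eq_zero_of_exhaustion` applies (the topological fibres are the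
scheme-theoretic ones, `exists_fiberHomeomorph`). In print (for `ν = θ_N` on an abelian scheme): `θ_N` acts on
`H¹(S, Rᵏ f_* ℚ) ⊂ H^{k+1}(𝒳)` as `Nᵏ`. [cite: VoisinHodgeII2003, §4.2.3 Thm. 4.15 and §1.2.2 Thm. 1.22]
[cite: Milne2020HodgeClassesAV, proof of Prop. 1 (p. 7)] [cite: Kleiman1968AlgebraicCycles, p. 374]
[cite: Milnor1963, §7 Thm. 7.2] -/
theorem map_eq_smul_of_forall_map_fiberι_eq_zero_of_affineCurveBase {n₀ : ℕ} (hf : IsSmoothProjectiveFamily f n₀)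
    [IsAffine S.left] [SmoothOfRelativeDimension 1 S.hom] (ν : 𝒳 ⟶ 𝒳) (hν : ν ≫ f = f) {k : ℕ} (c : ℂ)
    (hνF : ∀ s : Motives.ComplexPoints S, ∃ νs : Motives.fiberOver f s ⟶ Motives.fiberOver f s,
      νs ≫ Motives.fiberι f s = Motives.fiberι f s ≫ ν ∧
        ∀ x : complexBetti (Motives.fiberOver f s) k, complexBetti.map νs k x = c • x)
    (z : complexBetti 𝒳 (k + 1)) (hz : ∀ s, complexBetti.map (Motives.fiberι f s) (k + 1) z = 0) :
    complexBetti.map ν (k + 1) z = c • z := by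
  classical
  haveI : IsProper f.left := hf.isProper
  haveI : Smooth f.left := hf.smooth
  haveI : Smooth S.hom := SmoothOfRelativeDimension.smooth 1 _
  haveI : LocallyOfFiniteType S.hom := inferInstance
  haveI : IsSeparated S.hom := IsSeparated.of_isAffineHom S.hom
  haveI : IsSeparated 𝒳.hom := by rw [← Over.w f]; infer_instance
  haveI : T2Space (ComplexPoints 𝒳) := ComplexPoints.t2Space_of_isSeparated 𝒳
  have hp : IsSerreFibration (AlgPoints.map f : ComplexPoints 𝒳 → ComplexPoints S) :=
    isSerreFibration_map_of_smooth_proper f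
  -- the topological fibres are the scheme-theoretic fibres
  have he : ∀ s : ComplexPoints S, ∃ e : ComplexPoints (fiberOver f s) ≃ₜ
      ↥((AlgPoints.map f : ComplexPoints 𝒳 → ComplexPoints S) ⁻¹' {s}),
      ∀ x, ((e x : ↥((AlgPoints.map f : ComplexPoints 𝒳 → ComplexPoints S) ⁻¹' {s})) :
        ComplexPoints 𝒳) = AlgPoints.map (fiberι f s) x := fun s => exists_fiberHomeomorph f s
  choose e he using he
  have hefac : ∀ s, (subsetIncl ((AlgPoints.map f : ComplexPoints 𝒳 → ComplexPoints S) ⁻¹' {s})).comp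
      (e s : C(ComplexPoints (fiberOver f s), ↥((AlgPoints.map f : ComplexPoints 𝒳 → ComplexPoints S) ⁻¹' {s}))) =
      AlgPoints.mapContinuous (L := ℂ) (fiberι f s) := fun s => ContinuousMap.ext (he s)
  -- `ν(ℂ)` is a map over `S(ℂ)`
  let νt : C(ComplexPoints 𝒳, ComplexPoints 𝒳) := AlgPoints.mapContinuous (L := ℂ) ν
  have hνt : ∀ x, AlgPoints.map f (νt x) = AlgPoints.map f x := fun x => by
    change AlgPoints.map f (AlgPoints.map ν x) = AlgPoints.map f x
    rw [← AlgPoints.map_comp_apply, hν]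
  -- the fibre hypothesis on the topological fibres
  have hνFt : ∀ (b : ComplexPoints S)
      (νb : C(↥((AlgPoints.map f : ComplexPoints 𝒳 → ComplexPoints S) ⁻¹' {b}),
        ↥((AlgPoints.map f : ComplexPoints 𝒳 → ComplexPoints S) ⁻¹' {b}))),
      (∀ x, (νb x : ComplexPoints 𝒳) = νt x) →
      ∀ a : singularCohomology ℂ ℂ ↥((AlgPoints.map f : ComplexPoints 𝒳 → ComplexPoints S) ⁻¹' {b}) k,
        singularCohomology.map ℂ ℂ νb k a = c • a := by
    intro b νb hνb a
    obtain ⟨νs, hνs, hνsc⟩ := hνF b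
    -- `e_b ∘ ν_s(ℂ) = νb ∘ e_b` (both lie over `ν(ℂ) ∘ j_b(ℂ)`)
    have hcomm : ∀ x, e b (AlgPoints.mapContinuous (L := ℂ) νs x) = νb (e b x) := fun x => by
      apply Subtype.ext
      rw [he b, hνb, AlgPoints.mapContinuous_apply, ← AlgPoints.map_comp_apply, hνs, AlgPoints.map_comp_apply,
        ← he b x]
      rfl
    refine SerreFibrewiseScalar.cohomologyMap_eq_smul_of_homeomorph ℂ (e b).symm νb
      (AlgPoints.mapContinuous (L := ℂ) νs) (fun y => ?_) (fun a' => hνsc a') a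
    rw [Homeomorph.symm_apply_eq, hcomm, Homeomorph.apply_symm_apply]
  -- the class vanishes on the topological fibres
  have hz' : ∀ b : ComplexPoints S, singularCohomology.map ℂ ℂ
      (subsetIncl ((AlgPoints.map f : ComplexPoints 𝒳 → ComplexPoints S) ⁻¹' {b})) (k + 1) z = 0 := by
    intro b
    apply (SerreFlat.bijective_cohomologyMap_homeomorph ℂ (e b) (k + 1)).1
    rw [map_zero, ← ModuleCat.comp_apply, ← singularCohomology.map_comp, hefac b]
    exact hz b
  -- Andreotti–Frankel: the exhaustion of `S(ℂ)` by sublevel sets of a proper Morse function of index `≤ 1`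
  haveI : SmoothOfRelativeDimension (0 + 1) S.hom := by
    rw [Nat.zero_add]; infer_instance
  obtain ⟨φ, hφc, -, hφCW⟩ := AffineCoordinates.exists_sublevels_homotopyEquiv_cwComplex_of_isAffine (k := 0) S
  choose a ha hCWa using fun m : ℕ => hφCW (m : ℝ)
  let V : ℕ → Set (ComplexPoints S) := fun m => φ ⁻¹' Iio (m : ℝ)
  let M : ℕ → Set (ComplexPoints S) := fun m => φ ⁻¹' Iic (a m)
  have hVo : ∀ m, IsOpen (V m) := fun m => isOpen_Iio.preimage hφc
  have hVm : Monotone V := fun i j hij => preimage_mono (Iio_subset_Iio (Nat.cast_le.2 hij))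
  have hV : ⋃ m, V m = univ := by
    refine eq_univ_of_forall fun s => mem_iUnion.2 ⟨⌊φ s⌋₊ + 1, ?_⟩
    change φ s < ((⌊φ s⌋₊ + 1 : ℕ) : ℝ)
    push_cast
    exact Nat.lt_floor_add_one (φ s)
  have hVM : ∀ m, V m ⊆ M m := fun m s hs => le_of_lt (lt_trans (mem_Iio.1 hs) (ha m))
  have hCW : ∀ m, ∃ (X : Type) (_ : TopologicalSpace X) (_ : T2Space X)
      (_ : Topology.CWComplex (univ : Set X)),
      (∀ n, 1 < n → IsEmpty (Topology.RelCWComplex.cell (univ : Set X) n)) ∧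
        ∃ h : C(X, ↥(M m)), IsWeakHomotopyEquiv h := by
    intro m
    obtain ⟨C, _, _, _, -, hdim, ⟨ε⟩⟩ := hCWa m
    exact ⟨C, inferInstance, inferInstance, inferInstance, fun n hn => hdim n (by omega), ε.symm.toFun,
      isWeakHomotopyEquiv_homotopyEquiv ε.symm⟩
  -- the topological theorem over the exhausted base
  exact SerreFibrewiseScalar.map_eq_smul_of_forall_res_eq_zero_of_exhaustion ℂ hp νt hνt hνFt V hVo hVm hV M hVM
    hCW z hz'

end Family

end Literature.AlgebraicGeometry.HodgeTheory

end
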